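import Literature.NumberTheory.Transcendental.PureNaivePeriodMap
import Literature.AlgebraicGeometry.Motives.MotivatedCycles
import Literature.AlgebraicGeometry.Motives.PeriodComparison
import HarnessLib

/-!
# Motivated correspondences presented on affine models (definition request
# `defn-AffineMotivatedPresentation`)

Route `KontsevichZagierPeriods/MotivatedMoves` (rev 5) restates its crux *MotivatedTransfer* on
**affine homotopy models**: a smooth projective `X` over a number field `K ⊂ ℂ` (`σ : K →+* ℂ`) is
replaced by a Jouanolou torsor `p : X̃ = V(I) ⊆ 𝔸ᴺ_K → X` — `X̃` affine, a torsor under a vector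
bundle [Jouanolou 1973, Lemme 1.5], so that `p(ℂ)` is a homotopy equivalence and
`p^* : Hⁱ_dR(X/K) ≅ Hⁱ_dR(X̃/K) = Hⁱ(Ω^•_{K[x]/K} ⧸ vanishingForms I)` (Grothendieck's comparison
theorem [Grothendieck 1966, Thm. 1′] for `X` and for the smooth affine `X̃`, and base change) — on
which every de Rham class is a closed POLYNOMIAL form and every Betti class a closed ADMISSIBLE
CUBICAL cycle, the objects on which the pure naive period map of
`Literature/NumberTheory/Transcendental/PureNaivePeriodMap.lean` is defined. The crux then says:
every period identity induced by a MOTIVATED correspondence `ξ ∈ A_mot(X × Y)` [André 1996,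
§2.1 Déf. 1, Déf. 2] holds move-by-move in the Kontsevich–Zagier calculus. To TYPE it one needs
(this file; part (a), pull-back of forms, is `Motives/PolyFormPullback.lean`, and push-forward of
cubical chains is `NumberTheory/Transcendental/NaivePeriodsPushforward.lean`):

* `AffinePresentation P σ X` (part (b)) — for a period realization `P : PeriodRealization K`
  (`Motives/PeriodComparison.lean`: algebraic de Rham cohomology `P.dR`, Betti cohomology
  `P.B.comap σ` of `X_σ`, Grothendieck's comparison `P.iso σ X i`), a **presentation of the
  cohomology of `X` on an affine model `V(I) ⊆ 𝔸ᴺ`**: per degree `i`, a `K`-basis `(e_a)` of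
  `Hⁱ_dR(X)` and a `ℚ`-basis `(f_b)` of `Hⁱ_B(X_σ, ℚ)`, polynomial `i`-forms `ω_a` closed on
  `V(I)` whose classes form a `K`-basis of `Hⁱ_dR(V(I)/K)` (`AffineDeRham.DeRhamCohomology I i`)
  matched with `(e_a)` — the shadow of `p^*` —, closed admissible cubical `i`-cycles `γ_b` in
  `V(I)(ℂ)`, and THE PERIOD FORMULA: the period matrix of `P.iso σ X i` in the bases
  `(e_a), (f_b)` is `(∫_{γ_b} ω_a)_{b,a}` (`NaivePeriods.CubicalChain.integral σ`), i.e. `(f_b)` is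
  the basis dual to the homology classes `p(ℂ)_*[γ_b]` and the comparison is integration
  [Huber–Müller-Stach, Part I (2015), Thm. 5.3.3; book (2017), Def. 11.1.1].
* `IsMotivatedPeriodDatum PX PY i j M B s` (part (c)) — for presentations `PX`, `PY` of `X`, `Y`
  (smooth projective of dimensions `n`, `m`): the matrices `M ∈ Mat(K)`, `B ∈ Mat(ℚ)` and the
  Tate shift `s ∈ ℤ` are those of a **motivated correspondence**: there are a codimension `c`,
  a Betti class `ξ_B ∈ A_mot^c((X × Y)_σ)` (`WeilCohomology.motivatedClasses`,
  `Motives/MotivatedCycles.lean` — André's Déf. 1 on the Betti side) with de Rham partner `ξ`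
  (`P.iso (1 ⊗ ξ) = (2πi)^c (1 ⊗ ξ_B)`, [André 1996, §2.4–2.5; Deligne 1982, §1]), the induced
  operators `T = ξ_* : Hⁱ_dR(X) → Hʲ_dR(Y)` and `T_B = (ξ_B)_* : Hⁱ_B(X_σ) → Hʲ_B(Y_σ)`
  (`PreWeilCohomology.IsInducedBy`, Kleiman's pairing form), commuting with the comparison up to
  the twist `(2πi)^s`, `s = c - n` [André 1996, §2.4 p. 17: the comparison isomorphisms are
  compatible with cycle classes, cup products and pull-backs, hence with the action of
  correspondences; Deligne 1982, §1 for the twists], and `M`, `B` are the matrices of `T`, `T_B` in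
  the bases of `PX`, `PY`.
* `IsMotivatedPeriodDatum.sum_periods_eq` — PROVED: such a datum yields the numerical period
  identity `Σ_c σ(M_{ca}) ∫_{γ'_d} ω'_c = (2πi)^s Σ_b B_{db} ∫_{γ_b} ω_a`
  (linear algebra: `periodMatrix_eq_of_comm`), the identity the crux asserts to be a KZ relation.
* `AffineMotivatedPresentation P σ` — the bundle (varieties, presentations, degrees, `M`, `B`, `s`,
  motivatedness) that the crux quantifies over, with `sum_periods_eq` restated.
* Small API: `AffineDeRham.classOf`, `AffinePresentation.deRhamIso` (`Hⁱ_dR(X) ≃ Hⁱ_dR(V(I))`,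
  the shadow of `p^*`), `AffinePresentation.formOf` (the closed polynomial form of a de Rham
  class, e.g. of the de Rham cycle class `P.dR.cycleClass` of an algebraic cycle),
  `isClosedOn_formOf`, `classOf_formOf`.

## WARNING — interfaces, in the two-speed convention of the trunk

`PeriodRealization`, hence `AffinePresentation` and `IsMotivatedPeriodDatum`, are HYPOTHESIS
STRUCTURES: their intended values (algebraic de Rham cohomology, singular cohomology,
Grothendieck's comparison; Jouanolou models with the identifications above) satisfy every field
by the theorems cited at that field, but the tree constructs none of them (Mathlib has no
algebraic de Rham cohomology of projective varieties, no cycle class map, no comparison). Nothing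
here asserts existence: no `Nonempty` is claimed, and a statement `∀ PX : AffinePresentation …`
speaks about every model of these axioms. The fields pin exactly what the crux consumes: bases,
representing forms/cycles, the period formula, and the comparison-compatibility of the
correspondence. The torsor map `p` itself, smoothness of `V(I)` and projectivity are NOT fields
(they are not needed to state the crux; routes add them as hypotheses where a construction uses
them), exactly as in `PureNaivePeriodMap`.

## Design notes

* Bases are indexed by `Fin (PX.rank i)` (the common dimension of `Hⁱ_dR(X)` over `K` and
  `Hⁱ_B(X_σ)` over `ℚ`); degrees `i > 2 dim X` simply have `rank i = 0` in the intended instance.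
* Betti side through COHOMOLOGY and duality: the tree's Betti realization is cohomological
  (`P.B.comap σ`), so "the cycles `γ_b` represent a `ℚ`-basis of `H_i(X(ℂ), ℚ)`" is expressed by
  the dual cohomology basis `bettiBasis` and the period formula (Kronecker pairing), not by a map
  from cubical chains to singular homology of `ComplexPoints` (which would need `p(ℂ)` and
  subdivision of cubes).
* Conventions: `M = LinearMap.toMatrix (PX.dRBasis i) (PY.dRBasis j) T`, so
  `T e_a = Σ_c M_{ca} e'_c`; likewise `B` for `T_B` (the requester's `B_{bd}` is our `B_{db}`).
  `s ∈ ℤ` may be negative (push-forwards, `Λ`); `(2πi)^s` is a `zpow` in the field `AlongHom ℂ σ`.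
* Motivatedness is imposed on the Betti class `ξ_B` (André's reference cohomology; for `K ⊂ ℂ`
  the classical choice, §2.4) and `ξ` is its de Rham partner; that `ξ` is then motivated for
  `P.dR` and that `T`, `T_B` commute with the comparison are theorems for the classical
  realization (§2.3–2.4), recorded here as conjuncts (hypotheses), never derived from the abstract
  axioms.
* Mathlib/tree search: `motivated`, `periodMatrix`, `IsInducedBy`, `Jouanolou`, `comap` of forms
  — reused: `PeriodRealization`, `periodMatrixOf`, `WeilCohomology.motivatedClasses`,
  `PreWeilCohomology.IsInducedBy`, `AffineDeRham.*`, `NaivePeriods.*`; nothing redefined.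

## References

* Y. André, *Pour une théorie inconditionnelle des motifs*, Publ. Math. IHÉS 83 (1996): §2.1
  Déf. 1 (p. 14), Déf. 2 and Corollaire (p. 15: motivated correspondences, `f^*`, `f_*`), Prop. 2.3
  and §2.4 (p. 17: comparison isomorphisms), §2.5 (Tate twists). [Andre1996Motifs]
* J.-P. Jouanolou, *Une suite exacte de Mayer–Vietoris en K-théorie algébrique*, LNM 341 (1973),
  Lemme 1.5. [Jouanolou1973]
* A. Grothendieck, *On the de Rham cohomology of algebraic varieties*, Publ. IHÉS 29 (1966),
  Thm. 1, Thm. 1′, eq. (4). [Grothendieck1966]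
* A. Huber, S. Müller-Stach, *Periods and Nori motives*, Part I draft (2015), Thm. 5.3.3,
  Def. 5.4.1; book (2017), Def. 11.1.1, Thm. 12.2.1. [HuberMullerStachPeriodsI2015]
  [HuberMullerStachPeriods2017]
* P. Deligne, *Hodge cycles on abelian varieties*, LNM 900 (1982), §1. [Deligne1982HodgeCycles]
* M. Kontsevich, D. Zagier, *Periods* (2001), §1.2, §4.1. [KontsevichZagier2001]
-/

noncomputable section

open CategoryTheory MonoidalCategory
open scoped TensorProduct
open Literature.NumberTheory.Transcendental Literature.NumberTheory.Transcendental.NaivePeriods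

namespace Literature.AlgebraicGeometry.Motives

/-! ### Classes of closed polynomial forms -/

namespace AffineDeRham

variable {k : Type*} [CommRing k] {N p : ℕ} (I : Ideal (MvPolynomial (Fin N) k))

/-- The class `[ω|_{V(I)}] ∈ Hᵖ_dR(V(I)/k)` of a polynomial `p`-form `ω` closed on `V(I)`
(restriction to a closed regular form, then the quotient by exact forms). [folklore] -/
def classOf (ω : PolyForm k N p) (hω : IsClosedOn I ω) : DeRhamCohomology I p :=
  DeRhamCohomology.mk I ⟨RegularForm.mk I ω, (mk_mem_closedForms_iff I ω).mpr hω⟩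

/-- Two forms closed on `V(I)` have the same class iff their difference is exact on `V(I)`.
[folklore] -/
theorem classOf_eq_classOf_iff {ω₁ ω₂ : PolyForm k N p} (h₁ : IsClosedOn I ω₁)
    (h₂ : IsClosedOn I ω₂) : classOf I ω₁ h₁ = classOf I ω₂ h₂ ↔ IsExactOn I (ω₁ - ω₂) := by
  rw [classOf, classOf, ← sub_eq_zero, ← map_sub, DeRhamCohomology.mk_eq_zero_iff,
    ← mk_mem_exactForms_iff]
  rfl

/-- Closedness on `V(I)` is stable under sums. [folklore] -/
theorem IsClosedOn.add {ω₁ ω₂ : PolyForm k N p} (h₁ : IsClosedOn I ω₁) (h₂ : IsClosedOn I ω₂) :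
    IsClosedOn I (ω₁ + ω₂) := by
  unfold IsClosedOn at *
  rw [extDeriv_add]
  exact Submodule.add_mem _ h₁ h₂

/-- Closedness on `V(I)` is stable under scalars of `k`. [folklore] -/
theorem IsClosedOn.smul (c : k) {ω : PolyForm k N p} (h : IsClosedOn I ω) :
    IsClosedOn I (c • ω) := by
  unfold IsClosedOn at *
  rw [extDeriv_smul_const]
  exact Submodule.smul_of_tower_mem _ c h

/-- The zero form is closed on `V(I)`. [folklore] -/
theorem isClosedOn_zero : IsClosedOn I (0 : PolyForm k N p) := by
  unfold IsClosedOn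
  rw [extDeriv_zero]
  exact Submodule.zero_mem _

/-- Finite `k`-combinations of forms closed on `V(I)` are closed on `V(I)`. [folklore] -/
theorem isClosedOn_sum_smul {ι : Type*} (s : Finset ι) (c : ι → k) (ω : ι → PolyForm k N p)
    (h : ∀ a ∈ s, IsClosedOn I (ω a)) : IsClosedOn I (∑ a ∈ s, c a • ω a) := by
  induction s using Finset.cons_induction with
  | empty => simpa using isClosedOn_zero I
  | cons a s ha ih =>
    rw [Finset.sum_cons]
    exact (IsClosedOn.smul I (c a) (h a (Finset.mem_cons_self a s))).add I
      (ih fun b hb => h b (Finset.mem_cons_of_mem hb))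

/-- `classOf` is additive. [folklore] -/
theorem classOf_add {ω₁ ω₂ : PolyForm k N p} (h₁ : IsClosedOn I ω₁) (h₂ : IsClosedOn I ω₂) :
    classOf I (ω₁ + ω₂) (h₁.add I h₂) = classOf I ω₁ h₁ + classOf I ω₂ h₂ := by
  rw [classOf, classOf, classOf, ← map_add]
  rfl

/-- `classOf` is `k`-homogeneous. [folklore] -/
theorem classOf_smul (c : k) {ω : PolyForm k N p} (h : IsClosedOn I ω) :
    classOf I (c • ω) (h.smul I c) = c • classOf I ω h := by
  rw [classOf, classOf, ← map_smul]
  rfl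

end AffineDeRham

/-! ### Linear algebra: period matrices of comparison-compatible operators -/

section PeriodMatrix

variable {K₁ K₂ L : Type*} [Field K₁] [Field K₂] [Field L] [Algebra K₁ L] [Algebra K₂ L]
  {V₁ V₁' : Type*} [AddCommGroup V₁] [Module K₁ V₁] [AddCommGroup V₁'] [Module K₁ V₁']
  {V₂ V₂' : Type*} [AddCommGroup V₂] [Module K₂ V₂] [AddCommGroup V₂'] [Module K₂ V₂']
  {ι₁ ι₂ ι₁' ι₂' : Type*} [Fintype ι₁] [Fintype ι₂] [Fintype ι₁'] [Fintype ι₂']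
  [DecidableEq ι₁] [DecidableEq ι₂] [DecidableEq ι₁'] [DecidableEq ι₂']

/-- **Period matrices of operators commuting with the comparison.** Let
`ι : L ⊗_{K₁} V₁ → L ⊗_{K₂} V₂`, `ι' : L ⊗_{K₁} V₁' → L ⊗_{K₂} V₂'` be `L`-linear ("comparison"
maps), `T : V₁ → V₁'` (`K₁`-linear), `S : V₂ → V₂'` (`K₂`-linear) with
`ι'(1 ⊗ T x) = c · S_L(ι(1 ⊗ x))` for all `x`. Then in bases `b₁, b₁', b₂, b₂'`, with
`M = Mat(T)`, `B = Mat(S)` and period matrices `Π = Mat(ι)`, `Π' = Mat(ι')` (G17 `periodMatrix`):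
`Σ_{c'} M_{c'a} Π'_{dc'} = c · Σ_b B_{db} Π_{ba}`, i.e. `Π' M = c · B Π`. [folklore] -/
theorem periodMatrix_eq_of_comm (ι : L ⊗[K₁] V₁ →ₗ[L] L ⊗[K₂] V₂)
    (ι' : L ⊗[K₁] V₁' →ₗ[L] L ⊗[K₂] V₂') (T : V₁ →ₗ[K₁] V₁') (S : V₂ →ₗ[K₂] V₂') (c : L)
    (h : ∀ x : V₁, ι' (1 ⊗ₜ T x) = c • S.baseChange L (ι (1 ⊗ₜ x)))
    (b₁ : Module.Basis ι₁ K₁ V₁) (b₁' : Module.Basis ι₁' K₁ V₁') (b₂ : Module.Basis ι₂ K₂ V₂)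
    (b₂' : Module.Basis ι₂' K₂ V₂') (a : ι₁) (d : ι₂') :
    ∑ c' : ι₁', algebraMap K₁ L ((LinearMap.toMatrix b₁ b₁' T) c' a) * periodMatrix ι' b₁' b₂' d c' =
      c * ∑ b : ι₂, algebraMap K₂ L ((LinearMap.toMatrix b₂ b₂' S) d b) * periodMatrix ι b₁ b₂ b a := by
  have hT : T (b₁ a) = ∑ c' : ι₁', (LinearMap.toMatrix b₁ b₁' T) c' a • b₁' c' := by
    conv_lhs => rw [← Matrix.toLin_toMatrix b₁ b₁' T, Matrix.toLin_self]
  have hS : ∀ b : ι₂, S (b₂ b) = ∑ d' : ι₂', (LinearMap.toMatrix b₂ b₂' S) d' b • b₂' d' := fun b => by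
    conv_lhs => rw [← Matrix.toLin_toMatrix b₂ b₂' S, Matrix.toLin_self]
  have key : (b₂'.baseChange L).repr (ι' (1 ⊗ₜ[K₁] T (b₁ a))) d =
      (b₂'.baseChange L).repr (c • S.baseChange L (ι (1 ⊗ₜ[K₁] b₁ a))) d := by rw [h]
  -- left-hand side
  have lhs : (b₂'.baseChange L).repr (ι' (1 ⊗ₜ[K₁] T (b₁ a))) d =
      ∑ c' : ι₁', algebraMap K₁ L ((LinearMap.toMatrix b₁ b₁' T) c' a) *
        periodMatrix ι' b₁' b₂' d c' := by
    rw [hT, TensorProduct.tmul_sum, map_sum, map_sum, Finsupp.coe_finsetSum, Finset.sum_apply]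
    refine Finset.sum_congr rfl fun c' _ => ?_
    rw [TensorProduct.tmul_smul, ← IsScalarTower.algebraMap_smul L, map_smul, map_smul,
      Finsupp.smul_apply, smul_eq_mul, periodMatrix_apply]
  -- right-hand side
  have hx : ι (1 ⊗ₜ[K₁] b₁ a) = ∑ b : ι₂, periodMatrix ι b₁ b₂ b a • (1 ⊗ₜ[K₂] b₂ b) := by
    conv_lhs => rw [← (b₂.baseChange L).sum_repr (ι (1 ⊗ₜ[K₁] b₁ a))]
    refine Finset.sum_congr rfl fun b _ => ?_
    rw [periodMatrix_apply, Module.Basis.baseChange_apply]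
  have rhs : (b₂'.baseChange L).repr (c • S.baseChange L (ι (1 ⊗ₜ[K₁] b₁ a))) d =
      c * ∑ b : ι₂, algebraMap K₂ L ((LinearMap.toMatrix b₂ b₂' S) d b) *
        periodMatrix ι b₁ b₂ b a := by
    rw [map_smul, Finsupp.smul_apply, smul_eq_mul, hx, map_sum, map_sum, Finsupp.coe_finsetSum,
      Finset.sum_apply]
    congr 1
    refine Finset.sum_congr rfl fun b _ => ?_
    rw [map_smul, map_smul, Finsupp.smul_apply, smul_eq_mul, LinearMap.baseChange_tmul, hS b,
      TensorProduct.tmul_sum, map_sum, Finsupp.coe_finsetSum, Finset.sum_apply,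
      Finset.sum_eq_single d (fun d' _ hd' => ?_) (by simp), TensorProduct.tmul_smul,
      ← IsScalarTower.algebraMap_smul L, map_smul, Finsupp.smul_apply, smul_eq_mul,
      ← Module.Basis.baseChange_apply, Module.Basis.repr_self, Finsupp.single_apply, if_pos rfl,
      mul_one, mul_comm]
    rw [TensorProduct.tmul_smul, ← IsScalarTower.algebraMap_smul L, map_smul, Finsupp.smul_apply,
      smul_eq_mul, ← Module.Basis.baseChange_apply, Module.Basis.repr_self, Finsupp.single_apply,
      if_neg hd', mul_zero]
  rw [← lhs, key, rhs]

end PeriodMatrix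

/-! ### Affine presentations of the cohomology of a smooth projective variety -/

open AffineDeRham

variable {K : Type} [Field K] [CharZero K]

/-- An **affine presentation** of the cohomology of a `K`-variety `X` (intended: smooth projective),
along `σ : K →+* ℂ`, for a period realization `P` (`Motives/PeriodComparison.lean`): an affine
model `V(I) ⊆ 𝔸ᴺ_K` — intended: a Jouanolou torsor `p : X̃ = V(I) → X` [Jouanolou 1973,
Lemme 1.5] — together with, for every degree `i`,
* a `K`-basis `dRBasis i` of `Hⁱ_dR(X/K) = P.dR.obj X i` and a `ℚ`-basis `bettiBasis i` of
  `Hⁱ_B(X_σ, ℚ) = (P.B.comap σ).obj X i`, indexed by `Fin (rank i)`;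
* polynomial `i`-forms `form i a` on `𝔸ᴺ` closed on `V(I)` whose classes
  (`AffineDeRham.classOf`) are a `K`-basis `affineBasis i` of the algebraic de Rham cohomology
  `Hⁱ_dR(V(I)/K) = AffineDeRham.DeRhamCohomology I i` of the affine model, matched index-wise
  with `dRBasis i` — the shadow of the isomorphism `p^* : Hⁱ_dR(X) ≅ Hⁱ_dR(X̃)` (homotopy
  invariance for a torsor under a vector bundle, and `Hⁱ_dR(X̃) = Hⁱ(Γ(X̃, Ω^•))` for `X̃` affine
  [Grothendieck 1966, Thm. 1′ and eq. (4)]);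
* closed admissible cubical `i`-cycles `cycle i b` in `V(I)(ℂ)` (`NaivePeriods.CubicalChain`,
  `IsAdmissibleIn (complexZeroLocus σ I)`, boundary `0`);
* **the period formula**: the period matrix of the comparison `P.iso σ X i` in the bases
  `dRBasis i`, `bettiBasis i` (`P.periodMatrixOf`, Huber–Müller-Stach 2017, §11.2) has entries
  `∫_{γ_b} ω_a = NaivePeriods.CubicalChain.integral σ (form i a) (cycle i b)` — i.e. `bettiBasis i`
  is the cohomology basis dual to the homology classes `p(ℂ)_*[γ_b]` (`p(ℂ)` a homotopy
  equivalence) and the comparison isomorphism is computed by integrating forms along smooth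
  singular chains [Huber–Müller-Stach, Part I draft 2015, Thm. 5.3.3, Def. 5.4.1; 2017, Def. 11.1.1;
  Grothendieck 1966, Thm. 1′].
A HYPOTHESIS STRUCTURE (see the module docstring, § WARNING): the intended instance satisfies
the fields by the cited theorems; nothing asserts that an instance exists; the torsor map,
smoothness of `V(I)` and projectivity of `X` are not fields. Requested by route
KontsevichZagierPeriods/MotivatedMoves (item defn-AffineMotivatedPresentation, part (b)).
[cite: HuberMullerStachPeriodsI2015, Thm. 5.3.3 and Def. 5.4.1] -/
structure AffinePresentation (P : PeriodRealization K) (σ : K →+* ℂ) (X : SchemeOver K) where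
  /-- The dimension `N` of the ambient affine space of the model. -/
  N : ℕ
  /-- The ideal `I ⊆ K[x₁, …, x_N]` of the affine model `X̃ = V(I)`. -/
  ideal : Ideal (MvPolynomial (Fin N) K)
  /-- The common rank of `Hⁱ_dR(X/K)` and `Hⁱ_B(X_σ, ℚ)` (the `i`-th Betti number). -/
  rank : ℕ → ℕ
  /-- A `K`-basis `(e_a)` of `Hⁱ_dR(X/K)`. -/
  dRBasis (i : ℕ) : Module.Basis (Fin (rank i)) K (P.dR.obj X i)
  /-- A `ℚ`-basis `(f_b)` of `Hⁱ_B(X_σ, ℚ)`. -/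
  bettiBasis (i : ℕ) : Module.Basis (Fin (rank i)) ℚ ((P.B.comap σ).obj X i)
  /-- The representing polynomial `i`-forms `ω_a` on `𝔸ᴺ`. -/
  form (i : ℕ) : Fin (rank i) → PolyForm K N i
  /-- Each `ω_a` is closed on `V(I)`. -/
  form_isClosedOn : ∀ (i : ℕ) (a : Fin (rank i)), IsClosedOn ideal (form i a)
  /-- A `K`-basis of `Hⁱ_dR(V(I)/K)` (the target of `p^*`). -/
  affineBasis (i : ℕ) : Module.Basis (Fin (rank i)) K (DeRhamCohomology ideal i)
  /-- … consisting of the classes of the forms `ω_a` (so `p^* e_a = [ω_a]`). -/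
  affineBasis_apply : ∀ (i : ℕ) (a : Fin (rank i)),
    affineBasis i a = classOf ideal (form i a) (form_isClosedOn i a)
  /-- The representing cubical `i`-chains `γ_b` in `ℂᴺ`. -/
  cycle (i : ℕ) : Fin (rank i) → CubicalChain N i
  /-- Each `γ_b` is an admissible chain in `V(I)(ℂ)`. -/
  cycle_isAdmissibleIn : ∀ (i : ℕ) (b : Fin (rank i)),
    (cycle i b).IsAdmissibleIn (complexZeroLocus σ ideal)
  /-- Each `γ_b` is closed (no condition in degree `0`). -/
  boundary_cycle : ∀ (i : ℕ) (b : Fin (rank (i + 1))), CubicalChain.boundary (cycle (i + 1) b) = 0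
  /-- **The period formula**: the `(b, a)` entry of the period matrix of the comparison
  `P.iso σ X i` in the bases `(e_a)`, `(f_b)` is `∫_{γ_b} ω_a`. -/
  periodMatrixOf_eq_integral : ∀ (i : ℕ) (a b : Fin (rank i)),
    P.periodMatrixOf σ X i (dRBasis i) (bettiBasis i) b a =
      CubicalChain.integral σ (form i a) (cycle i b)

namespace AffinePresentation

variable {P : PeriodRealization K} {σ : K →+* ℂ} {X : SchemeOver K} (PX : AffinePresentation P σ X)

/-- The isomorphism `Hⁱ_dR(X/K) ≃ Hⁱ_dR(V(I)/K)` carried by a presentation, `e_a ↦ [ω_a]` (the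
shadow of `p^*` for the intended Jouanolou torsor `p`). [folklore] -/
def deRhamIso (i : ℕ) : P.dR.obj X i ≃ₗ[K] DeRhamCohomology PX.ideal i :=
  (PX.dRBasis i).equiv (PX.affineBasis i) (Equiv.refl _)

/-- `deRhamIso e_a = [ω_a]`. [folklore] -/
@[simp]
theorem deRhamIso_dRBasis (i : ℕ) (a : Fin (PX.rank i)) :
    PX.deRhamIso i (PX.dRBasis i a) = classOf PX.ideal (PX.form i a) (PX.form_isClosedOn i a) := by
  rw [deRhamIso, Module.Basis.equiv_apply, Equiv.refl_apply, PX.affineBasis_apply]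

/-- **The polynomial form of a de Rham class**: `x = Σ_a x_a e_a ↦ Σ_a x_a ω_a`, a polynomial
`i`-form on `𝔸ᴺ` closed on `V(I)` representing `p^* x`. For `x = P.dR.cycleClass X c z` this is
a closed polynomial form representing the de Rham cycle class of the cycle `closure {z}` on the
affine model. [folklore] -/
def formOf {i : ℕ} (x : P.dR.obj X i) : PolyForm K PX.N i :=
  ∑ a, (PX.dRBasis i).repr x a • PX.form i a

/-- `formOf` is additive. [folklore] -/
theorem formOf_add {i : ℕ} (x y : P.dR.obj X i) : PX.formOf (x + y) = PX.formOf x + PX.formOf y := by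
  simp only [formOf, map_add, Finsupp.add_apply, add_smul, Finset.sum_add_distrib]

/-- `formOf` is `K`-linear. [folklore] -/
theorem formOf_smul {i : ℕ} (c : K) (x : P.dR.obj X i) : PX.formOf (c • x) = c • PX.formOf x := by
  simp only [formOf, map_smul, Finsupp.smul_apply, smul_eq_mul, ← smul_smul, ← Finset.smul_sum]

/-- The form of a basis class is the given representing form: `formOf e_a = ω_a`. [folklore] -/
@[simp]
theorem formOf_dRBasis (i : ℕ) (a : Fin (PX.rank i)) : PX.formOf (PX.dRBasis i a) = PX.form i a := by
  rw [formOf, Finset.sum_eq_single a (fun b _ hb => ?_) (by simp)]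
  · rw [Module.Basis.repr_self, Finsupp.single_eq_same, one_smul]
  · rw [Module.Basis.repr_self, Finsupp.single_apply, if_neg (Ne.symm hb), zero_smul]

/-- `formOf x` is closed on `V(I)`. [folklore] -/
theorem isClosedOn_formOf {i : ℕ} (x : P.dR.obj X i) : IsClosedOn PX.ideal (PX.formOf x) :=
  isClosedOn_sum_smul PX.ideal _ _ _ fun a _ => PX.form_isClosedOn i a

/-- The class of `formOf x` is `deRhamIso x` (`= p^* x`): the presentation represents EVERY de Rham
class of `X` by a closed polynomial form on the affine model. [folklore] -/
theorem classOf_formOf {i : ℕ} (x : P.dR.obj X i) :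
    classOf PX.ideal (PX.formOf x) (PX.isClosedOn_formOf x) = PX.deRhamIso i x := by
  have key : ∀ (s : Finset (Fin (PX.rank i))) (c : Fin (PX.rank i) → K)
      (h : IsClosedOn PX.ideal (∑ a ∈ s, c a • PX.form i a)),
      classOf PX.ideal (∑ a ∈ s, c a • PX.form i a) h = ∑ a ∈ s, c a • PX.affineBasis i a := by
    intro s c
    induction s using Finset.cons_induction with
    | empty =>
      intro h
      simp only [Finset.sum_empty]
      rw [classOf, ← (DeRhamCohomology.mk PX.ideal).map_zero]
      rfl
    | cons a s ha ih =>
      intro h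
      have h' : IsClosedOn PX.ideal (∑ b ∈ s, c b • PX.form i b) :=
        isClosedOn_sum_smul PX.ideal _ _ _ fun b _ => PX.form_isClosedOn i b
      simp only [Finset.sum_cons]
      rw [← ih h', PX.affineBasis_apply, ← classOf_smul, ← classOf_add]
  conv_rhs => rw [← (PX.dRBasis i).sum_repr x, map_sum]
  simp only [map_smul, deRhamIso_dRBasis, ← PX.affineBasis_apply]
  exact key _ _ _

end AffinePresentation

/-! ### Motivated period data -/

section Motivated

variable {P : PeriodRealization K} {σ : K →+* ℂ} {n m : ℕ} {X Y : SchemeOver K}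

/-- **Motivated period datum** (route KontsevichZagierPeriods/MotivatedMoves, part (c)). For affine
presentations `PX` of `X` and `PY` of `Y` (intended: smooth projective of dimensions `n`, `m` over
the number field `K`, `σ : K →+* ℂ`) and degrees `i`, `j`: the matrices `M ∈ Mat(K)`,
`B ∈ Mat(ℚ)` and the Tate shift `s ∈ ℤ` **are the de Rham and Betti matrices of a motivated
correspondence** from `X` to `Y` [André 1996, §2.1 Déf. 1, Déf. 2]: there are a codimension `c`
(with `j + j' = 2m`, `i + 2c + j' = 2(n + m)`, i.e. `j = i + 2(c - n)`), a RATIONAL Betti class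
`ξ_B ∈ H^{2c}_B((X × Y)_σ, ℚ)` lying in André's space of motivated classes
`A_mot^c((X × Y)_σ) = P.B.W.motivatedClasses (n + m) (X × Y)_σ c` (`Motives/MotivatedCycles.lean`:
spans of `pr_*(α ∪ ⋆β)`, `α`, `β` algebraic, `⋆` a Lefschetz involution), a de Rham class
`ξ ∈ H^{2c}_dR(X × Y / K)` which is its partner under the comparison,
`P.iso (1 ⊗ ξ) = (2πi)^c (1 ⊗ ξ_B)` [André 1996, §2.4–2.5; Deligne 1982, §1], the operators
`T = ξ_* : Hⁱ_dR(X) → Hʲ_dR(Y)` and `T_B = (ξ_B)_* : Hⁱ_B(X_σ) → Hʲ_B(Y_σ)` induced by them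
(`PreWeilCohomology.IsInducedBy`, Kleiman 1968 §1.3: `x ↦ pr_{Y*}(pr_X^* x ∪ ξ)`), which commute
with the comparison up to the twist `(2πi)^s`, `s = c - n`:
`P.iso_Y (1 ⊗ T x) = (2πi)^s · (T_B)_ℂ (P.iso_X (1 ⊗ x))` [André 1996, §2.4 p. 17: the comparison
isomorphisms are compatible with cycle classes — up to `(2πi)^codim`, Deligne 1982, §1 —, with cup
products and pull-backs, hence with push-forwards and the action of correspondences], such that
`M = Mat(T)` in the bases `PX.dRBasis i`, `PY.dRBasis j` and `B = Mat(T_B)` in `PX.bettiBasis i`,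
`PY.bettiBasis j` (`LinearMap.toMatrix`: `T e_a = Σ_c M_{ca} e'_c`). Consequence PROVED below
(`sum_periods_eq`): `Σ_c σ(M_{ca}) ∫_{γ'_d} ω'_c = (2πi)^s Σ_b B_{db} ∫_{γ_b} ω_a`. A predicate on
hypothesis structures (module docstring, § WARNING); the comparison-compatibility conjunct is the
printed theorem for the classical realization, carried as a hypothesis, not derived.
[cite: Andre1996Motifs, §2.1 Déf. 1–2 (pp. 14–15) and §2.4 (p. 17)] -/
def IsMotivatedPeriodDatum (n m : ℕ) (PX : AffinePresentation P σ X) (PY : AffinePresentation P σ Y)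
    (i j : ℕ) (M : Matrix (Fin (PY.rank j)) (Fin (PX.rank i)) K)
    (B : Matrix (Fin (PY.rank j)) (Fin (PX.rank i)) ℚ) (s : ℤ) : Prop :=
  ∃ (c j' : ℕ) (hj : j + j' = 2 * m) (hm : i + 2 * c + j' = 2 * (n + m))
    (ξ : P.dR.obj (X ⊗ Y) (2 * c)) (ξB : (P.B.comap σ).obj (X ⊗ Y) (2 * c))
    (T : P.dR.obj X i →ₗ[K] P.dR.obj Y j)
    (TB : (P.B.comap σ).obj X i →ₗ[ℚ] (P.B.comap σ).obj Y j),
    ξB ∈ P.B.W.motivatedClasses (n + m) ((baseChangeHom σ).obj (X ⊗ Y)) c ∧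
    P.iso σ (X ⊗ Y) (2 * c) ((1 : AlongHom ℂ σ) ⊗ₜ[K] ξ) =
      twoPiI σ ^ c • ((1 : AlongHom ℂ σ) ⊗ₜ[ℚ] ξB) ∧
    P.dR.IsInducedBy n m ξ T hj hm ∧
    (P.B.comap σ).IsInducedBy n m ξB TB hj hm ∧
    (∀ x : P.dR.obj X i, P.iso σ Y j ((1 : AlongHom ℂ σ) ⊗ₜ[K] T x) =
      twoPiI σ ^ s • TB.baseChange (AlongHom ℂ σ) (P.iso σ X i ((1 : AlongHom ℂ σ) ⊗ₜ[K] x))) ∧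
    s = (c : ℤ) - n ∧
    M = LinearMap.toMatrix (PX.dRBasis i) (PY.dRBasis j) T ∧
    B = LinearMap.toMatrix (PX.bettiBasis i) (PY.bettiBasis j) TB

namespace IsMotivatedPeriodDatum

variable {PX : AffinePresentation P σ X} {PY : AffinePresentation P σ Y} {i j : ℕ}
  {M : Matrix (Fin (PY.rank j)) (Fin (PX.rank i)) K} {B : Matrix (Fin (PY.rank j)) (Fin (PX.rank i)) ℚ}
  {s : ℤ}

/-- The degrees of a motivated period datum differ by twice the Tate shift: `j = i + 2s`.
[folklore] -/
theorem degree_eq (h : IsMotivatedPeriodDatum n m PX PY i j M B s) : (j : ℤ) = i + 2 * s := by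
  obtain ⟨c, j', hj, hm, -, -, -, -, -, -, -, -, -, hs, -, -⟩ := h
  omega

/-- **Motivated correspondences act on period matrices** (abstract form): for a motivated period
datum, `Σ_c σ(M_{ca}) Π^Y_{dc} = (2πi)^s Σ_b B_{db} Π^X_{ba}` for the period matrices `Π^X`,
`Π^Y` of the comparison in the bases of `PX`, `PY` (from the comparison-compatibility conjunct,
`periodMatrix_eq_of_comm`). [cite: Andre1996Motifs, §2.4 (p. 17)] -/
theorem sum_periodMatrixOf_eq (h : IsMotivatedPeriodDatum n m PX PY i j M B s)
    (a : Fin (PX.rank i)) (d : Fin (PY.rank j)) :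
    ∑ c, σ (M c a) * P.periodMatrixOf σ Y j (PY.dRBasis j) (PY.bettiBasis j) d c =
      (2 * Real.pi * Complex.I) ^ s *
        ∑ b, (B d b : ℂ) * P.periodMatrixOf σ X i (PX.dRBasis i) (PX.bettiBasis i) b a := by
  obtain ⟨c, j', hj, hm, ξ, ξB, T, TB, -, -, -, -, hcomm, -, rfl, rfl⟩ := h
  have key := periodMatrix_eq_of_comm (P.iso σ X i) (P.iso σ Y j) T TB (twoPiI σ ^ s) hcomm
    (PX.dRBasis i) (PY.dRBasis j) (PX.bettiBasis i) (PY.bettiBasis j) a d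
  apply_fun AlongHom.equiv σ at key
  simp only [map_sum, map_mul, map_zpow₀, AlongHom.equiv_algebraMap, eq_ratCast, map_ratCast,
    show AlongHom.equiv σ (twoPiI σ) = 2 * Real.pi * Complex.I from
      RingEquiv.apply_symm_apply _ _] at key
  simpa only [PeriodRealization.periodMatrixOf, Matrix.map_apply] using key

/-- **The period identity of a motivated correspondence on the affine models**: for a motivated
period datum `(M, B, s)` between presentations `PX` of `X` and `PY` of `Y`,
`Σ_c σ(M_{ca}) ∫_{γ'_d} ω'_c = (2πi)^s Σ_b B_{db} ∫_{γ_b} ω_a` for all `a`, `d` — the identity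
whose move-by-move validity in the Kontsevich–Zagier calculus is the crux *MotivatedTransfer*
(from `sum_periodMatrixOf_eq` and the period formulas of `PX`, `PY`).
[cite: Andre1996Motifs, §2.4 (p. 17)] -/
theorem sum_periods_eq (h : IsMotivatedPeriodDatum n m PX PY i j M B s)
    (a : Fin (PX.rank i)) (d : Fin (PY.rank j)) :
    ∑ c, σ (M c a) * CubicalChain.integral σ (PY.form j c) (PY.cycle j d) =
      (2 * Real.pi * Complex.I) ^ s *
        ∑ b, (B d b : ℂ) * CubicalChain.integral σ (PX.form i a) (PX.cycle i b) := by
  have key := h.sum_periodMatrixOf_eq a d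
  simp only [PX.periodMatrixOf_eq_integral, PY.periodMatrixOf_eq_integral] at key
  exact key

end IsMotivatedPeriodDatum

end Motivated

/-! ### The bundle the crux quantifies over -/

/-- An **affine motivated presentation** along `σ : K →+* ℂ` for a period realization `P`: smooth
projective `X`, `Y` over `K` (dimensions `n`, `m`), affine presentations `PX`, `PY` of their
cohomology (Jouanolou models with representing closed polynomial forms and closed admissible
cubical cycles, `AffinePresentation`), degrees `i`, `j`, and a motivated period datum `(M, B, s)`
(`IsMotivatedPeriodDatum`: the matrices and Tate shift of a motivated correspondence
`ξ ∈ A_mot(X × Y)`, André 1996 Déf. 1–2). This is the datum over which route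
KontsevichZagierPeriods/MotivatedMoves quantifies its crux *MotivatedTransfer*: for every such
datum and every (normalised, Stokes) pure naive period map, the identity `sum_periods_eq` is to
hold in `KZ.FormalRep × KZ.FormalRep` modulo `KZ.relations₂`. Hypothesis structure (module
docstring, § WARNING). [cite: Andre1996Motifs, §2.1 Déf. 1–2 (pp. 14–15)] -/
structure AffineMotivatedPresentation (P : PeriodRealization K) (σ : K →+* ℂ) where
  /-- The dimension of `X`. -/
  n : ℕ
  /-- The dimension of `Y`. -/
  m : ℕ
  /-- The source variety. -/
  X : SchemeOver K
  /-- The target variety. -/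
  Y : SchemeOver K
  /-- `X` is smooth projective of dimension `n`. -/
  isSmoothProjective_X : IsSmoothProjective n X
  /-- `Y` is smooth projective of dimension `m`. -/
  isSmoothProjective_Y : IsSmoothProjective m Y
  /-- The affine presentation of the cohomology of `X`. -/
  PX : AffinePresentation P σ X
  /-- The affine presentation of the cohomology of `Y`. -/
  PY : AffinePresentation P σ Y
  /-- The source degree. -/
  i : ℕ
  /-- The target degree. -/
  j : ℕ
  /-- The de Rham matrix of the correspondence. -/
  M : Matrix (Fin (PY.rank j)) (Fin (PX.rank i)) K
  /-- The Betti matrix of the correspondence. -/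
  B : Matrix (Fin (PY.rank j)) (Fin (PX.rank i)) ℚ
  /-- The Tate shift. -/
  s : ℤ
  /-- `(M, B, s)` are the matrices and shift of a motivated correspondence. -/
  isMotivatedPeriodDatum : IsMotivatedPeriodDatum n m PX PY i j M B s

namespace AffineMotivatedPresentation

variable {P : PeriodRealization K} {σ : K →+* ℂ} (D : AffineMotivatedPresentation P σ)

/-- The period identity carried by an affine motivated presentation:
`Σ_c σ(M_{ca}) ∫_{γ'_d} ω'_c = (2πi)^s Σ_b B_{db} ∫_{γ_b} ω_a`.
[cite: Andre1996Motifs, §2.4 (p. 17)] -/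
theorem sum_periods_eq (a : Fin (D.PX.rank D.i)) (d : Fin (D.PY.rank D.j)) :
    ∑ c, σ (D.M c a) * CubicalChain.integral σ (D.PY.form D.j c) (D.PY.cycle D.j d) =
      (2 * Real.pi * Complex.I) ^ D.s *
        ∑ b, (D.B d b : ℂ) * CubicalChain.integral σ (D.PX.form D.i a) (D.PX.cycle D.i b) :=
  D.isMotivatedPeriodDatum.sum_periods_eq a d

/-- The degrees differ by twice the Tate shift. [folklore] -/
theorem degree_eq : (D.j : ℤ) = D.i + 2 * D.s := D.isMotivatedPeriodDatum.degree_eq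

end AffineMotivatedPresentation

end Literature.AlgebraicGeometry.Motives

end
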